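import Literature.MathematicalPhysics.QuantumFieldTheory.Balaban1983to89.B9Thm39CubeOpsAtLettersY

/-!
# `Balaban1983to89.B9Thm39FibreReadoutAtLettersY` — THE READ-OUT FROM def-Y's `𝔸`-LEVEL LETTERS TO [4]'s (2.51) BLOCK MAJORANTS on the carrier
# `X39 = 𝔅 × κ39`: a FIBRE-KERNEL BOUND `‖(O f)(s)‖ ≤ Σ_{s′} K(s, s′)‖f(s′)‖` for an `𝔸`-linear letter `O` gives `HasMajorant (blk39F bI) (realify39 basis39 (r • O))`
# with the (3.48)-shape majorant — the currency in which rows 15–16's schemas `Local348Blk ∕ Small285Blk ∕ Conv348Blk` are typed — and hence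
# rows 15–16's LOCAL (3.48) (`Local348Blk` at `cubeOps39YF`) from an `𝔸`-level kernel bound on `(□̃ Q′G′_□²Q′* □̃)⁻¹(U)`

statement-level skeleton of published theorems with citation tags; proofs where landed; nothing here is a claim about the
Yang–Mills mass gap

T. Bałaban, *Propagators for lattice gauge theories in a background field*, Commun. Math. Phys. **99** (1985) 389–434
[`Balaban1985BackgroundPropagators`, "[B9]"]; [4] = T. Bałaban, *Propagators and renormalization transformations for lattice gauge theories. II*,
Commun. Math. Phys. **96** (1984) 223–250 [`Balaban1984PropagatorsII`].  PDF held (`paper:balaban1985-cmp99-background-propagators`, journal page = PDF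
page + 388); p. 398 and pp. 408–411 re-read by this seat (2026-08-28); [4] (2.51) p. 232, (2.61) p. 234, (2.86)–(2.87) p. 238 as quoted in this lineage's
`B9Thm39WholeBlk` ∕ `B9Conv348AtOneLettersY`.

THE PRINT (verbatim).  [B9] (3.48) p. 398: *«|(Q′(U)G′²(U)Q′\*(U))⁻¹(y, y′)| ≤ B₀(L^jη)^{−4}(L^{j′}η)^{−d}e^{−δ₀d(y,y′)}, (y ∈ Λ_j, y′ ∈ Λ_{j′})»*; [4] (2.51) p. 232:
*«|(Tλ)(x)| ≤ K(y, y′)|λ|, x ∈ B(y), supp λ ⊂ B(y′)»*; [4] Lemma 2.1 (2.61) p. 234 (row sums of `e^{−δd(y,y′)}` over the blocks).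

WHY THIS FILE (cell context, pub-ymgap N06 DAG).  Rows 15–16's displayed binder `h348` and — after this lineage's W-h instance `cubeOps39YF` (p608171) — its
local schemas `Local348Blk ∕ Small285Blk` are typed in [4]'s (2.51) block-majorant currency `B6RandomWalk.HasMajorant` on g14's REAL-COORDINATE carrier
`X39 = 𝔅 × κ39` (operators `realify39 basis39 (r • O)`), whereas every analytic seat of the node (def-Y, n06-w1, n06-i, …) proves bounds for def-Y's
`𝔸`-LINEAR letters `O : (BlkY → 𝔸) →ₗ (BlkY → 𝔸)` in fibre-norm currency.  g14's `B9Conv348AtOneLettersY.hasMajorant_invL39_one_F` read the ONE scalar-kernel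
letter `unit39⁻¹ • liftMatY GiM` out at `U = 1`; this file is the GENERAL read-out promised there (HANDOFF §g18 recipe): any fibre-kernel bound
`‖(O f)(s)‖ ≤ Σ_{s′} K(s, s′)‖f(s′)‖` with `|r|·K(s, s′) ≤ C·ℓ(s)⁻⁴·e^{−(δ/2)d(s,s′)}` yields `HasMajorant (blk39F bI) (realify39 basis39 (r • O))` with the (3.48)-shape
majorant `(cR·C·c_L·e^{δ/2})·ℓ(y)⁻⁴·e^{−(δ/4)d(y,y′)}` (fibres of the faithful block map summed through (2.61), torus facts at the faithful representatives), and
the local schema `Local348Blk (cubeOps39YF …) … U` follows from such a bound for the `𝔸`-operator `(M_{𝟙_Dblk}·Q′G′_□²Q′\*(U)·M_{𝟙_Dblk} + 1 − M_{𝟙_Dblk})⁻¹` of every cube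
— an `𝔸`-level target for the local (3.48) (Cor. 3.6 at the local operators).

WHAT IS PROVED (sorry-free; 0 `def`).
* §1 (generic: finite `S`, basis `b` of `𝔸`) `abs_realify39_smul_apply_le_of_fibreKernel`: from `hK : ∀ f s, ‖O f s‖ ≤ Σ_{s′} K s s′·‖f s′‖`,
  `|(realify39 b (r • O) μ)(s, c)| ≤ coordBound·|r|·Σ_{s′} K s s′·(basisBound·Σ_{c′}|μ(s′, c′)|)` (`realify39_apply`, `coordEquiv39_(symm_)apply`, `abs_repr_le`,
  `norm_sum_smul_basis_le`); `sum_abs_le_card_mul_of_blockSupp` (a fibre-supported `μ` with `|μ| ≤ B`: `Σ_{c′}|μ(s′,c′)| ≤ |κ|·B` on the fibre, `0` off it).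
* §2 ★★ `hasMajorant_realify39_of_fibreKernel_F`: at a member `x`, a 1-faithful `bI` (`hβ1`), a weight `W ≥ 0` on the geometry sites, a fibre-kernel bound `hK`
  with shape `|r|·K s s′ ≤ C·W(rep s)·e^{−(δ₁/2)·distB s s′}` and the torus row sum `Σ_{s′} e^{−(δ₁/4)·distB s s′} ≤ c_L` ⇒ `HasMajorant (blk39F 𝔸 i bI)
  (realify39 basis39 (r • O)) (fun a b => (cR39·C·c_L·e^{δ₁/2})·W a·e^{−(δ₁/4)·dist a b})` — g14's §5 argument VERBATIM after the generic first step; the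
  (3.48)-weight `W = ℓ⁻⁴` instance `…_F_len4` (level-faithful `bI`, `len_rep39F`) is the currency of `Local348Blk ∕ Conv348Blk`, the constant weight that of `Small285Blk`.
* §3 ★ `ringInverse_realify39`, `ringInverse_smul` (units read through `realify39` and non-zero scalars), ★★★ `local348Blk_cubeOps39YF_of_fibreKernel`: rows 15–16's
  `Local348Blk (cubeOps39YF 𝔏 bI 𝒞 x) (cR39·C·c_L·e^{δ₁/2}) (δ₁/4) U` from, for every cube `c`, a fibre-kernel bound on the `𝔸`-level local inverse
  `Ring.inverse (dirPadY (M_{𝟙_{Dblk c}}) (XY i parS (GsqY i parS (D c)) U))` with shape `unit39⁻¹·K_c s s′ ≤ C·lenB s⁻⁴·e^{−(δ₁/2)·distB s s′}` (+ `hβ1`, `hlev`, the row sum, and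
  the unit hypothesis, which `isUnit_padX_parSymY` discharges at `parSymY`).

HONEST SCOPE.  Bookkeeping between two typed currencies; no inequality of [B9]∕[4] is proved or asserted — the fibre-kernel bounds ARE the analytic content and
stay hypotheses (for §3: Theorem 3.2 for the local operators, Cor. 3.6).  Constants: `cR39 basis39` (the algebra and its basis), `C`, `c_L`, `δ₁` (the supplier's).
`𝔸` any finite-dimensional complete normed ℂ-algebra in §1–§2 (the record: `M_N(ℂ)` in §3).  Count-neutral (no new named fact; N06 NOT discharged); nothing
continuum, nothing about OS axioms or the mass gap.  No `sorry`, no `axiom`, no `instance`, no `notation`.  Seat `pub-ymgap-dag-n06-j` (bundle F5, rows 15–17),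
gen 20, 2026-08-28; NEW file; imports this lineage's `B9Thm39CubeOpsAtLettersY` (p608171); modifies nothing.
-/

noncomputable section

namespace Literature.MathematicalPhysics.QuantumFieldTheory.Balaban1983to89.B9Thm39FibreReadoutAtLettersY

open Finset B6RandomWalk B9Thm39WholeBlk B9Thm39ReadingCoords B9Thm39ReadingAtLetters B9Thm39OneCubeReadingAtLettersY B9Thm39CubeOpsAtLettersY
  B9Thm311LocalInversePosY Node00 Node00.OpsYLocalInverse
open B9Thm37CubeCoverCommutators (cutMulY)
open B6KLevelCensusIndexV1 B6Geom246MultiLevelBox B6Geom246MultiLevelTorus B6Ineq2142KLevelV1 B6GlobalChartV1 B6Ineq288MultiLevelTorus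
  B9Ineq349SiteComposite B9Ineq349SiteFromBlocks B9Ineq349SiteFromConv348 B9PinMembersKLevelV1 B9PinCarriersKLevelV1 B9PinGeometryKLevelV1 B7Prop2SpecialUnitary
open scoped Matrix

/-! ## §1 The generic first step: a fibre-kernel bound controls every real coordinate of `realify39 b (r • O)` -/

section Generic

variable {𝔸 : Type} [NormedRing 𝔸] [NormedAlgebra ℂ 𝔸] [FiniteDimensional ℝ 𝔸]
variable {S κ : Type} [Fintype S] [Fintype κ]

omit [FiniteDimensional ℝ 𝔸] [Fintype S] in
/-- the fibre value of a coordinate vector is the basis combination of its coordinates, hence `‖f(s′)‖ ≤ basisBound·Σ_{c′}|μ(s′, c′)|`.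
[cite: Balaban1985BackgroundPropagators, p.389 («A with values in the Lie algebra»), dictionary] -/
theorem norm_coordEquiv39_apply_le (b : Module.Basis κ ℝ 𝔸) (μ : S × κ → ℝ) (s' : S) :
    ‖coordEquiv39 b μ s'‖ ≤ basisBound39 b * ∑ c', |μ (s', c')| := by
  rw [coordEquiv39_apply]
  exact norm_sum_smul_basis_le b fun c' => μ (s', c')

/-- ★ **THE GENERIC READ-OUT STEP**: if the `𝔸`-linear letter `O` obeys the fibre-kernel bound `‖(O f)(s)‖ ≤ Σ_{s′} K(s, s′)‖f(s′)‖`, then every real coordinate of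
`realify39 b (r • O)` is controlled by `K`: `|(realify39 b (r • O) μ)(s, c)| ≤ coordBound·|r|·Σ_{s′} K(s, s′)·(basisBound·Σ_{c′}|μ(s′, c′)|)`.
[cite: Balaban1984PropagatorsII, (2.51) p.232; Balaban1985BackgroundPropagators, (3.48) p.398 (kernels read through a norm), dictionary] -/
theorem abs_realify39_smul_apply_le_of_fibreKernel (b : Module.Basis κ ℝ 𝔸) {O : (S → 𝔸) →ₗ[ℂ] (S → 𝔸)} {K : S → S → ℝ}
    (hK0 : ∀ s s', 0 ≤ K s s') (hK : ∀ (f : S → 𝔸) (s : S), ‖O f s‖ ≤ ∑ s', K s s' * ‖f s'‖) (r : ℝ) (μ : S × κ → ℝ) (p : S × κ) :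
    |realify39 b (((r : ℝ) : ℂ) • O) μ p| ≤ coordBound39 b * (|r| * ∑ s', K p.1 s' * (basisBound39 b * ∑ c', |μ (s', c')|)) := by
  rw [realify39_apply, coordEquiv39_symm_apply]
  have h1 := abs_repr_le b (((((r : ℝ) : ℂ) • O) (coordEquiv39 b μ)) p.1) p.2
  refine h1.trans (mul_le_mul_of_nonneg_left ?_ (norm_nonneg _))
  have hsm : ((((r : ℝ) : ℂ) • O) (coordEquiv39 b μ)) p.1 = (r : ℝ) • (O (coordEquiv39 b μ) p.1) := by
    rw [LinearMap.smul_apply, Pi.smul_apply, Complex.coe_smul]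
  rw [hsm, norm_smul, Real.norm_eq_abs]
  refine mul_le_mul_of_nonneg_left ?_ (abs_nonneg r)
  refine (hK (coordEquiv39 b μ) p.1).trans (Finset.sum_le_sum fun s' _ => ?_)
  exact mul_le_mul_of_nonneg_left (norm_coordEquiv39_apply_le b μ s') (hK0 p.1 s')

omit [Fintype S] in
/-- the fibre sum of a block-supported coordinate vector OVER the block `y′`: `Σ_{c′}|μ(s′, c′)| ≤ |κ|·B`.
[cite: Balaban1984PropagatorsII, (2.51) p.232 («supp λ ⊂ B(y′)», «|λ|»), bookkeeping] -/
theorem sum_abs_le_of_blockSupp_of_eq {G : B6.Geometry} {blk : S × κ → G.Site} (hblk : ∀ s c c', blk (s, c) = blk (s, c'))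
    {μ : S × κ → ℝ} {y' : G.Site} {B : ℝ} (hμ : BlockSupp blk μ y' B) {s' : S} {c₀ : κ} (h : blk (s', c₀) = y') :
    ∑ c', |μ (s', c')| ≤ (Fintype.card κ : ℝ) * B := by
  calc ∑ c', |μ (s', c')| ≤ ∑ _c' : κ, B := Finset.sum_le_sum fun c' _ => hμ.bound (s', c') (by rw [hblk s' c' c₀]; exact h)
    _ = (Fintype.card κ : ℝ) * B := by rw [Finset.sum_const, nsmul_eq_mul, Finset.card_univ]

omit [Fintype S] in
/-- … and OFF the block `y′` it vanishes. [cite: Balaban1984PropagatorsII, (2.51) p.232, bookkeeping] -/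
theorem sum_abs_eq_zero_of_blockSupp_of_ne {G : B6.Geometry} {blk : S × κ → G.Site} (hblk : ∀ s c c', blk (s, c) = blk (s, c'))
    {μ : S × κ → ℝ} {y' : G.Site} {B : ℝ} (hμ : BlockSupp blk μ y' B) {s' : S} {c₀ : κ} (h : blk (s', c₀) ≠ y') :
    ∑ c', |μ (s', c')| = 0 := by
  refine Finset.sum_eq_zero fun c' _ => ?_
  rw [hμ.off (s', c') (by rw [hblk s' c' c₀]; exact h), abs_zero]

end Generic

/-! ## §2 At a member, on the faithful block map: the (3.48)-shape block majorant from a fibre-kernel bound -/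

section Member

open scoped Matrix.Norms.L2Operator

variable {𝔸 : Type} [NormedRing 𝔸] [NormedAlgebra ℂ 𝔸] [CompleteSpace 𝔸] [FiniteDimensional ℂ 𝔸]
variable {d ℓ : ℕ} {hd : 1 ≤ d + 1} {hL : Odd (ℓ + 1) ∧ 1 < ℓ + 1} {b₀ b₁ : ℝ} {Mstar : ℕ}

/-- `e^{−2ρ a} ≤ e^{ρ}·e^{−ρ b}·e^{−ρ a}` whenever `b ≤ a + 1` (`ρ ≥ 0`): half of the decay pays for the triangle inequality (g14's splitting).
[cite: Balaban1984PropagatorsII, (2.54) p.233, bookkeeping] -/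
private theorem exp_split {ρ a b : ℝ} (hρ : 0 ≤ ρ) (hab : b ≤ a + 1) :
    Real.exp (-(2 * ρ * a)) ≤ Real.exp ρ * Real.exp (-(ρ * b)) * Real.exp (-(ρ * a)) := by
  rw [← Real.exp_add, ← Real.exp_add]
  apply Real.exp_le_exp.2
  nlinarith [mul_le_mul_of_nonneg_left hab hρ]

omit [CompleteSpace 𝔸] in
/-- ★★ **THE READ-OUT**: at a member `x` with a 1-faithful, level-faithful bond map `bI`, an `𝔸`-linear letter `O` on the block lattice with the FIBRE-KERNEL BOUND
`‖(O f)(s)‖ ≤ Σ_{s′} K(s, s′)‖f(s′)‖`, `|r|·K(s, s′) ≤ C·ℓ(s)⁻⁴·e^{−(δ₁/2)d(s,s′)}`, and the torus row sum `Σ_{s′} e^{−(δ₁/4)d(s,s′)} ≤ c_L`, has the (3.48)-shape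
(2.51) block majorant `(cR39·C·c_L·e^{δ₁/2})·ℓ(y)⁻⁴·e^{−(δ₁/4)d(y,y′)}` for `realify39 basis39 (r • O)` w.r.t. `blk39F … bI` — the fibre over `y′` summed through
(2.61), lengths and distances read at the faithful representatives (`len_rep39F`, `distB_beta_rep39F_le_one`).
[cite: Balaban1984PropagatorsII, (2.51) p.232 + Lemma 2.1 (2.61) p.234 + (2.54) p.233; Balaban1985BackgroundPropagators, (3.48) p.398] -/
theorem hasMajorant_realify39_of_fibreKernel_F (x : MemberY d ℓ hd hL b₀ b₁ Mstar) [Fintype (geo9Y x).Site]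
    {bI : FBondY x.toKIdx → IBondY x.toKIdx}
    (hβ1 : ∀ f : FBondY x.toKIdx, (geomT x.D).dist (β x.hN x.D x.hk (bI f)) (blkV1 x.hN x.D f) ≤ 1)
    {O : (BlkY x.toKIdx → 𝔸) →ₗ[ℂ] (BlkY x.toKIdx → 𝔸)} {K : BlkY x.toKIdx → BlkY x.toKIdx → ℝ} {r C δ₁ cL : ℝ}
    {W : (geo9Y x).Site → ℝ} (hW : ∀ a, 0 ≤ W a)
    (hC : 0 ≤ C) (hδ₁ : 0 ≤ δ₁) (hcL : 0 ≤ cL) (hK0 : ∀ s s', 0 ≤ K s s')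
    (hK : ∀ (f : BlkY x.toKIdx → 𝔸) (s : BlkY x.toKIdx), ‖O f s‖ ≤ ∑ s', K s s' * ‖f s'‖)
    (hshape : ∀ s s' : BlkY x.toKIdx, |r| * K s s' ≤ C * W (rep39F x.toKIdx bI s) * Real.exp (-(δ₁ / 2 * distB x.toKIdx s s')))
    (hrow : ∀ y : BlkY x.toKIdx, ∑ y' : BlkY x.toKIdx, Real.exp (-(1 / 2 * (δ₁ / 2) * distB x.toKIdx y y')) ≤ cL) :
    HasMajorant (g := b6 (geo9Y x)) (blk39F 𝔸 x.toKIdx bI) (realify39 (basis39 𝔸) (((r : ℝ) : ℂ) • O))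
      (fun (a b : (geo9Y x).Site) => (cR39 (basis39 𝔸) * C * cL * Real.exp (δ₁ / 2)) * W a *
        Real.exp (-(δ₁ / 4 * (geo9Y x).dist a b))) := by
  classical
  intro y' μ Bd hμ p
  obtain ⟨s, c⟩ := p
  have hρ0 : (0 : ℝ) ≤ δ₁ / 4 := by positivity
  have hBd : 0 ≤ Bd := hμ.nonneg
  have hcb : 0 ≤ coordBound39 (basis39 𝔸) := norm_nonneg _
  have hbb : 0 ≤ basisBound39 (basis39 𝔸) := Finset.sum_nonneg fun _ _ => norm_nonneg _
  have hblk : ∀ (s₁ : BlkY x.toKIdx) (c₁ c₂ : κ39 𝔸), blk39F 𝔸 x.toKIdx bI (s₁, c₁) = blk39F 𝔸 x.toKIdx bI (s₁, c₂) := fun _ _ _ => rfl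
  -- step 1: the generic read-out
  have h1 := abs_realify39_smul_apply_le_of_fibreKernel (basis39 𝔸) hK0 hK r μ (s, c)
  -- the torus facts at the faithful representatives
  have hnear : ∀ s' : BlkY x.toKIdx, blk39F 𝔸 x.toKIdx bI (s', c) = y' →
      distB x.toKIdx s (β x.hN x.D x.hk y') ≤ distB x.toKIdx s s' + 1 := by
    intro s' hs'
    have hs'' : rep39F x.toKIdx bI s' = y' := hs'
    have h1 : distB x.toKIdx (β x.hN x.D x.hk y') s' ≤ 1 := by
      have := distB_beta_rep39F_le_one x hβ1 s'
      rwa [hs''] at this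
    have h2 : distB x.toKIdx s' (β x.hN x.D x.hk y') ≤ 1 := by
      have hsymm : distB x.toKIdx s' (β x.hN x.D x.hk y') = distB x.toKIdx (β x.hN x.D x.hk y') s' := dist_symm_geoBT (toKT x.toKIdx) _ _
      rw [hsymm]; exact h1
    linarith [distB_triangle x.toKIdx s s' (β x.hN x.D x.hk y')]
  -- step 2: termwise bound of `|r|·K(s,s′)·(basisBound·Σ_{c′}|μ(s′,c′)|)`
  have hterm : ∀ s' : BlkY x.toKIdx, |r| * K s s' * (basisBound39 (basis39 𝔸) * ∑ c', |μ (s', c')|) ≤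
      C * W (rep39F x.toKIdx bI s) * Real.exp (δ₁ / 4) * Real.exp (-((δ₁ / 4) * distB x.toKIdx s (β x.hN x.D x.hk y'))) *
        (basisBound39 (basis39 𝔸) * ((Fintype.card (κ39 𝔸) : ℝ) * Bd)) * Real.exp (-(1 / 2 * (δ₁ / 2) * distB x.toKIdx s s')) := by
    intro s'
    have hK0' : 0 ≤ C * W (rep39F x.toKIdx bI s) * Real.exp (δ₁ / 4) * Real.exp (-((δ₁ / 4) * distB x.toKIdx s (β x.hN x.D x.hk y'))) *
        (basisBound39 (basis39 𝔸) * ((Fintype.card (κ39 𝔸) : ℝ) * Bd)) * Real.exp (-(1 / 2 * (δ₁ / 2) * distB x.toKIdx s s')) := by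
      have := hW (rep39F x.toKIdx bI s)
      positivity
    by_cases hs' : blk39F 𝔸 x.toKIdx bI (s', c) = y'
    · have hfib := sum_abs_le_of_blockSupp_of_eq hblk hμ hs'
      have h12 : Real.exp (-(δ₁ / 2 * distB x.toKIdx s s')) ≤
          Real.exp (δ₁ / 4) * Real.exp (-((δ₁ / 4) * distB x.toKIdx s (β x.hN x.D x.hk y'))) * Real.exp (-(1 / 2 * (δ₁ / 2) * distB x.toKIdx s s')) := by
        have e1 : δ₁ / 2 * distB x.toKIdx s s' = 2 * (δ₁ / 4) * distB x.toKIdx s s' := by ring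
        have e2 : 1 / 2 * (δ₁ / 2) * distB x.toKIdx s s' = (δ₁ / 4) * distB x.toKIdx s s' := by ring
        rw [e1, e2]
        exact exp_split hρ0 (hnear s' hs')
      calc |r| * K s s' * (basisBound39 (basis39 𝔸) * ∑ c', |μ (s', c')|)
          ≤ (C * W (rep39F x.toKIdx bI s) * Real.exp (-(δ₁ / 2 * distB x.toKIdx s s'))) *
              (basisBound39 (basis39 𝔸) * ((Fintype.card (κ39 𝔸) : ℝ) * Bd)) :=
            mul_le_mul (hshape s s') (mul_le_mul_of_nonneg_left hfib hbb) (mul_nonneg hbb (Finset.sum_nonneg fun _ _ => abs_nonneg _))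
              (mul_nonneg (mul_nonneg hC (hW _)) (Real.exp_pos _).le)
        _ ≤ (C * W (rep39F x.toKIdx bI s) *
              (Real.exp (δ₁ / 4) * Real.exp (-((δ₁ / 4) * distB x.toKIdx s (β x.hN x.D x.hk y'))) * Real.exp (-(1 / 2 * (δ₁ / 2) * distB x.toKIdx s s')))) *
              (basisBound39 (basis39 𝔸) * ((Fintype.card (κ39 𝔸) : ℝ) * Bd)) :=
            mul_le_mul_of_nonneg_right (mul_le_mul_of_nonneg_left h12 (mul_nonneg hC (hW _)))
              (by positivity)
        _ = _ := by ring
    · have hz : ∑ c', |μ (s', c')| = 0 := sum_abs_eq_zero_of_blockSupp_of_ne hblk hμ hs'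
      rw [hz, mul_zero, mul_zero]
      exact hK0'
  -- step 3: sum and (2.61)
  set A : ℝ := C * W (rep39F x.toKIdx bI s) * Real.exp (δ₁ / 4) * Real.exp (-((δ₁ / 4) * distB x.toKIdx s (β x.hN x.D x.hk y'))) *
    (basisBound39 (basis39 𝔸) * ((Fintype.card (κ39 𝔸) : ℝ) * Bd)) with hA
  have hA0 : 0 ≤ A := by
    have := hW (rep39F x.toKIdx bI s)
    positivity
  have hsum : |r| * ∑ s', K s s' * (basisBound39 (basis39 𝔸) * ∑ c', |μ (s', c')|) ≤ A * cL := by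
    rw [Finset.mul_sum]
    calc ∑ s', |r| * (K s s' * (basisBound39 (basis39 𝔸) * ∑ c', |μ (s', c')|))
        ≤ ∑ s', A * Real.exp (-(1 / 2 * (δ₁ / 2) * distB x.toKIdx s s')) :=
          Finset.sum_le_sum fun s' _ => by rw [← mul_assoc]; exact hterm s'
      _ = A * ∑ s', Real.exp (-(1 / 2 * (δ₁ / 2) * distB x.toKIdx s s')) := by rw [Finset.mul_sum]
      _ ≤ A * cL := mul_le_mul_of_nonneg_left (hrow s) hA0
  -- step 4: lengths and distances at the faithful representatives, assemble
  have hdist : (geo9Y x).dist (rep39F x.toKIdx bI s) y' ≤ distB x.toKIdx s (β x.hN x.D x.hk y') + 1 := by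
    rw [geo9Y_dist_eq_distB]
    have h1 : distB x.toKIdx (β x.hN x.D x.hk (rep39F x.toKIdx bI s)) s ≤ 1 := distB_beta_rep39F_le_one x hβ1 s
    linarith [distB_triangle x.toKIdx (β x.hN x.D x.hk (rep39F x.toKIdx bI s)) s (β x.hN x.D x.hk y')]
  have hexp : Real.exp (-((δ₁ / 4) * distB x.toKIdx s (β x.hN x.D x.hk y'))) ≤
      Real.exp (δ₁ / 4) * Real.exp (-((δ₁ / 4) * (geo9Y x).dist (rep39F x.toKIdx bI s) y')) := by
    rw [← Real.exp_add]
    apply Real.exp_le_exp.2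
    nlinarith [mul_le_mul_of_nonneg_left hdist hρ0]
  have htot := h1.trans (mul_le_mul_of_nonneg_left hsum hcb)
  refine htot.trans ?_
  have hbf : blk39F 𝔸 x.toKIdx bI (s, c) = rep39F x.toKIdx bI s := rfl
  have hl4 : 0 ≤ W (rep39F x.toKIdx bI s) := hW _
  have hcard : (0 : ℝ) ≤ Fintype.card (κ39 𝔸) := Nat.cast_nonneg _
  rw [hA]
  beta_reduce
  rw [hbf]
  calc coordBound39 (basis39 𝔸) * (C * W (rep39F x.toKIdx bI s) * Real.exp (δ₁ / 4) *
        Real.exp (-((δ₁ / 4) * distB x.toKIdx s (β x.hN x.D x.hk y'))) * (basisBound39 (basis39 𝔸) * ((Fintype.card (κ39 𝔸) : ℝ) * Bd)) * cL)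
      ≤ coordBound39 (basis39 𝔸) * (C * W (rep39F x.toKIdx bI s) * Real.exp (δ₁ / 4) *
        (Real.exp (δ₁ / 4) * Real.exp (-((δ₁ / 4) * (geo9Y x).dist (rep39F x.toKIdx bI s) y'))) *
          (basisBound39 (basis39 𝔸) * ((Fintype.card (κ39 𝔸) : ℝ) * Bd)) * cL) := by
        refine mul_le_mul_of_nonneg_left ?_ hcb
        have h0 : 0 ≤ C * W (rep39F x.toKIdx bI s) * Real.exp (δ₁ / 4) := by positivity
        exact mul_le_mul_of_nonneg_right (mul_le_mul_of_nonneg_right (mul_le_mul_of_nonneg_left hexp h0) (by positivity)) hcL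
    _ = cR39 (basis39 𝔸) * C * cL * Real.exp (δ₁ / 2) * W (rep39F x.toKIdx bI s) *
          Real.exp (-(δ₁ / 4 * (geo9Y x).dist (rep39F x.toKIdx bI s) y')) * Bd := by
        have e : Real.exp (δ₁ / 2) = Real.exp (δ₁ / 4) * Real.exp (δ₁ / 4) := by rw [← Real.exp_add]; ring_nf
        rw [e, cR39]
        ring

omit [CompleteSpace 𝔸] in
/-- ★ **the (3.48)-weight instance**: with a LEVEL-faithful `bI` (`hlev`) and the shape `|r|·K(s, s′) ≤ C·ℓ(s)⁻⁴·e^{−(δ₁/2)d(s,s′)}`, the majorant is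
`(cR39·C·c_L·e^{δ₁/2})·ℓ(y)⁻⁴·e^{−(δ₁/4)d(y,y′)}` — the currency of `Local348Blk ∕ Conv348Blk`. [cite: Balaban1985BackgroundPropagators, (3.48) p.398; Balaban1984PropagatorsII, (2.51) p.232, (2.86) p.238] -/
theorem hasMajorant_realify39_of_fibreKernel_F_len4 (x : MemberY d ℓ hd hL b₀ b₁ Mstar) [Fintype (geo9Y x).Site]
    {bI : FBondY x.toKIdx → IBondY x.toKIdx}
    (hβ1 : ∀ f : FBondY x.toKIdx, (geomT x.D).dist (β x.hN x.D x.hk (bI f)) (blkV1 x.hN x.D f) ≤ 1)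
    (hlev : ∀ f : FBondY x.toKIdx, lvl x.hN x.D x.hk (bI f) = (blkV1 x.hN x.D f).1.1)
    {O : (BlkY x.toKIdx → 𝔸) →ₗ[ℂ] (BlkY x.toKIdx → 𝔸)} {K : BlkY x.toKIdx → BlkY x.toKIdx → ℝ} {r C δ₁ cL : ℝ}
    (hC : 0 ≤ C) (hδ₁ : 0 ≤ δ₁) (hcL : 0 ≤ cL) (hK0 : ∀ s s', 0 ≤ K s s')
    (hK : ∀ (f : BlkY x.toKIdx → 𝔸) (s : BlkY x.toKIdx), ‖O f s‖ ≤ ∑ s', K s s' * ‖f s'‖)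
    (hshape : ∀ s s' : BlkY x.toKIdx, |r| * K s s' ≤ C * lenB x.toKIdx s ^ (-(4 : ℝ)) * Real.exp (-(δ₁ / 2 * distB x.toKIdx s s')))
    (hrow : ∀ y : BlkY x.toKIdx, ∑ y' : BlkY x.toKIdx, Real.exp (-(1 / 2 * (δ₁ / 2) * distB x.toKIdx y y')) ≤ cL) :
    HasMajorant (g := b6 (geo9Y x)) (blk39F 𝔸 x.toKIdx bI) (realify39 (basis39 𝔸) (((r : ℝ) : ℂ) • O))
      (fun (a b : (geo9Y x).Site) => (cR39 (basis39 𝔸) * C * cL * Real.exp (δ₁ / 2)) * (geo9Y x).len a ^ (-(4 : ℝ)) *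
        Real.exp (-(δ₁ / 4 * (geo9Y x).dist a b))) :=
  hasMajorant_realify39_of_fibreKernel_F x hβ1 (W := fun a => (geo9Y x).len a ^ (-(4 : ℝ)))
    (fun a => Real.rpow_nonneg (B9GeoLemma21KLevelV1.geo9Y_len_pos x a).le _) hC hδ₁ hcL hK0 hK
    (fun s s' => by rw [len_rep39F x hlev s]; exact hshape s s') hrow

end Member

/-! ## §3 Units read through the chart, and rows 15–16's LOCAL (3.48) from an `𝔸`-level kernel bound on the local inverses -/

section Local

open scoped Matrix.Norms.L2Operator
open B9Thm39ReadingFaithful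

/-- the `Ring.inverse` of a unit read through `realify39` is `realify39` of its `Ring.inverse`. [cite: Balaban1985BackgroundPropagators, (3.48) p.398 (the inverse letter), bookkeeping] -/
theorem ringInverse_realify39 {𝔸 : Type} [NormedRing 𝔸] [NormedAlgebra ℂ 𝔸] {S κ : Type} [Fintype κ]
    (b : Module.Basis κ ℝ 𝔸) {O : (S → 𝔸) →ₗ[ℂ] (S → 𝔸)} (hO : IsUnit O) :
    Ring.inverse (realify39 b O) = realify39 b (Ring.inverse O) := by
  have hR : IsUnit (realify39 b O) := isUnit_realify39 b hO
  have hinv : realify39 b O * realify39 b (Ring.inverse O) = 1 := by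
    rw [← realify39_mul, Ring.mul_inverse_cancel O hO, realify39_one]
  calc Ring.inverse (realify39 b O) = Ring.inverse (realify39 b O) * (realify39 b O * realify39 b (Ring.inverse O)) := by rw [hinv, mul_one]
    _ = realify39 b (Ring.inverse O) := by rw [← mul_assoc, Ring.inverse_mul_cancel _ hR, one_mul]

/-- the `Ring.inverse` of a non-zero scalar multiple of a unit of `End_ℂ`: `(c • O)⁻¹ = c⁻¹ • O⁻¹`. [cite: Balaban1985BackgroundPropagators, Thm 3.2 p.398 (units), bookkeeping] -/
theorem ringInverse_smul {V : Type} [AddCommGroup V] [Module ℂ V] {c : ℂ} (hc : c ≠ 0) {O : Module.End ℂ V} (hO : IsUnit O) :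
    Ring.inverse (c • O) = c⁻¹ • Ring.inverse O := by
  have hcO : IsUnit (c • O) := isUnit_smul_of_ne_zero hc hO
  have hinv : (c • O) * (c⁻¹ • Ring.inverse O) = 1 := by
    rw [smul_mul_smul_comm, mul_inv_cancel₀ hc, one_smul, Ring.mul_inverse_cancel O hO]
  calc Ring.inverse (c • O) = Ring.inverse (c • O) * ((c • O) * (c⁻¹ • Ring.inverse O)) := by rw [hinv, mul_one]
    _ = c⁻¹ • Ring.inverse O := by rw [← mul_assoc, Ring.inverse_mul_cancel _ hcO, one_mul]

variable {N : ℕ} {θ : Stage3Params} {Mstar : ℕ} (𝔏 : LettersY N θ Mstar)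
variable [∀ x : MemberY θ.d₆ θ.ℓ₆ θ.hd' θ.hL' θ.b₀ θ.b₁ Mstar, Fintype (geo9Y x).Site]
  [∀ x : MemberY θ.d₆ θ.ℓ₆ θ.hd' θ.hL' θ.b₀ θ.b₁ Mstar, DecidableEq (geo9Y x).Site]
variable (bI : ∀ x : MemberY θ.d₆ θ.ℓ₆ θ.hd' θ.hL' θ.b₀ θ.b₁ Mstar, FBondY x.toKIdx → IBondY x.toKIdx)
variable {ι : MemberY θ.d₆ θ.ℓ₆ θ.hd' θ.hL' θ.b₀ θ.b₁ Mstar → Type} (𝒞 : ∀ x, CubeData39 θ Mstar (ι x) x)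

omit [∀ x : MemberY θ.d₆ θ.ℓ₆ θ.hd' θ.hL' θ.b₀ θ.b₁ Mstar, Fintype (geo9Y x).Site]
  [∀ x : MemberY θ.d₆ θ.ℓ₆ θ.hd' θ.hL' θ.b₀ θ.b₁ Mstar, DecidableEq (geo9Y x).Site] in
/-- the local inverse letter `C_□(U)` of `cubeOps39YF`, as `realify39` of the `𝔸`-LEVEL local inverse scaled by `unit39⁻¹` (whenever the padded compression
of `Q′G′_□²Q′*(U)` is a unit — always, at `parSymY`). [cite: Balaban1985BackgroundPropagators, (3.87) p.409 (C_□), (3.96) p.411, bookkeeping] -/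
theorem cubeOps39YF_Cl_eq_realify39_inverse (x : MemberY θ.d₆ θ.ℓ₆ θ.hd' θ.hL' θ.b₀ θ.b₁ Mstar)
    (U : (bg9Y (Matrix (Fin N) (Fin N) ℂ) (specialUnitaryUnits (Fin N)) x).Cfg) (c : ι x)
    (hU : IsUnit (dirPadY (cutMulY (blkIndY x.toKIdx ((𝒞 x).Dblk c))) (XY x.toKIdx (𝔏 x).parS (GsqY x.toKIdx (𝔏 x).parS ((𝒞 x).D c)) U))) :
    (cubeOps39YF 𝔏 bI 𝒞 x).Cl U c
      = realify39 (basis39 (Matrix (Fin N) (Fin N) ℂ)) ((((unit39 x.toKIdx)⁻¹ : ℝ) : ℂ) •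
          Ring.inverse (dirPadY (cutMulY (blkIndY x.toKIdx ((𝒞 x).Dblk c))) (XY x.toKIdx (𝔏 x).parS (GsqY x.toKIdx (𝔏 x).parS ((𝒞 x).D c)) U))) := by
  have hne : ((unit39 x.toKIdx : ℝ) : ℂ) ≠ 0 := by exact_mod_cast (unit39_pos x.toKIdx).ne'
  rw [cubeOps39YF_Cl, Cl39, Lloc39, ringInverse_realify39 _ (isUnit_smul_of_ne_zero hne hU), ringInverse_smul hne hU, Complex.ofReal_inv]

omit [∀ x : MemberY θ.d₆ θ.ℓ₆ θ.hd' θ.hL' θ.b₀ θ.b₁ Mstar, DecidableEq (geo9Y x).Site] in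
/-- ★★★ **ROWS 15–16's LOCAL (3.48) FROM AN `𝔸`-LEVEL FIBRE-KERNEL BOUND ON THE LOCAL INVERSES**: at a member with a 1-∕level-faithful `bI`, if for every cube `c` the
`𝔸`-operator `(M_{𝟙_{Dblk c}}·Q′G′_□²Q′*(U)·M_{𝟙_{Dblk c}} + 1 − M_{𝟙_{Dblk c}})⁻¹` is a unit obeying `‖(· f)(s)‖ ≤ Σ_{s′} K_c(s, s′)‖f(s′)‖` with `unit39⁻¹·K_c(s, s′) ≤
C·ℓ(s)⁻⁴·e^{−(δ₁/2)d(s,s′)}` (Theorem 3.2's (3.48) for the LOCAL operator in fibre currency, print's units), and the torus row sum is `≤ c_L`, then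
`Local348Blk (cubeOps39YF 𝔏 bI 𝒞 x) (cR39·C·c_L·e^{δ₁/2}) (δ₁/4) U`. [cite: Balaban1985BackgroundPropagators, p.409 («C_□(U) … satisfy all the inequalities of Theorems 3.1–3.3»), Thm 3.2 (3.48) p.398; Balaban1984PropagatorsII, (2.51) p.232, (2.61) p.234] -/
theorem local348Blk_cubeOps39YF_of_fibreKernel (x : MemberY θ.d₆ θ.ℓ₆ θ.hd' θ.hL' θ.b₀ θ.b₁ Mstar)
    (hβ1 : ∀ f : FBondY x.toKIdx, (geomT x.D).dist (β x.hN x.D x.hk (bI x f)) (blkV1 x.hN x.D f) ≤ 1)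
    (hlev : ∀ f : FBondY x.toKIdx, lvl x.hN x.D x.hk (bI x f) = (blkV1 x.hN x.D f).1.1)
    (U : (bg9Y (Matrix (Fin N) (Fin N) ℂ) (specialUnitaryUnits (Fin N)) x).Cfg) {C δ₁ cL : ℝ} (hC : 0 ≤ C) (hδ₁ : 0 ≤ δ₁) (hcL : 0 ≤ cL)
    (hrow : ∀ y : BlkY x.toKIdx, ∑ y' : BlkY x.toKIdx, Real.exp (-(1 / 2 * (δ₁ / 2) * distB x.toKIdx y y')) ≤ cL)
    (K : ι x → BlkY x.toKIdx → BlkY x.toKIdx → ℝ) (hK0 : ∀ c s s', 0 ≤ K c s s')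
    (hU : ∀ c, IsUnit (dirPadY (cutMulY (blkIndY x.toKIdx ((𝒞 x).Dblk c))) (XY x.toKIdx (𝔏 x).parS (GsqY x.toKIdx (𝔏 x).parS ((𝒞 x).D c)) U)))
    (hK : ∀ (c : ι x) (f : BlkY x.toKIdx → Matrix (Fin N) (Fin N) ℂ) (s : BlkY x.toKIdx),
      ‖Ring.inverse (dirPadY (cutMulY (blkIndY x.toKIdx ((𝒞 x).Dblk c))) (XY x.toKIdx (𝔏 x).parS (GsqY x.toKIdx (𝔏 x).parS ((𝒞 x).D c)) U)) f s‖
        ≤ ∑ s', K c s s' * ‖f s'‖)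
    (hshape : ∀ (c : ι x) (s s' : BlkY x.toKIdx),
      |(unit39 x.toKIdx)⁻¹| * K c s s' ≤ C * lenB x.toKIdx s ^ (-(4 : ℝ)) * Real.exp (-(δ₁ / 2 * distB x.toKIdx s s'))) :
    Local348Blk (cubeOps39YF 𝔏 bI 𝒞 x) (cR39 (basis39 (Matrix (Fin N) (Fin N) ℂ)) * C * cL * Real.exp (δ₁ / 2)) (δ₁ / 4) U where
  cl := fun c => by
    rw [cubeOps39YF_Cl_eq_realify39_inverse 𝔏 bI 𝒞 x U c (hU c)]
    exact hasMajorant_realify39_of_fibreKernel_F_len4 x hβ1 hlev hC hδ₁ hcL (hK0 c) (hK c) (hshape c) hrow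

end Local

end Literature.MathematicalPhysics.QuantumFieldTheory.Balaban1983to89.B9Thm39FibreReadoutAtLettersY

end
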